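import Mathlib
import HarnessLib
import Summits.SmoothPoincare4.SmoothPoincare4.Theses.WrinkleUnlinking

/-!
# Birth skeleton (BC3) — crux `WrinkleUnlinking.DepthTwoCollapse` (stmt-SmoothPoincare4-10373)

Route `route-SmoothPoincare4-WrinkleUnlinking`, crux #4 `DepthTwoCollapse` (the COMPLEXITY-COLLAPSE half of the
thesis X = DepthTwoRung ∧ DepthTwoCollapse): every homotopy 4-sphere `M` (exactly the binders of `SmoothPoincare4`)
admits a degree-one wrinkled map `p : M → S⁴` with `k` wrinkles on discs `D : Fin k → Set M` (the route's inlined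
predicate `IsW`, Eliashberg–Mishachev normal form `w(y,z) = (y, z³ + 3(|y|²−1)z)` on each disc) whose LENS DEPTH is
`≤ 2`: no point of `S⁴` lies in three of the lens images `p '' (D i)`.

THE LINE = the route's own foreseen glued split of this node (route file, TWO-LAYER PLAN: "DepthTwoCollapse ⇐
WrinkledExistence → DepthReduction (any degree-one wrinkled map is [modified] to one of depth ≤ 2) →
DepthTwoCollapse"), typed WITHOUT new vocabulary and with the reduction organised as a ONE-STEP DESCENT on the
maximal lens depth, so that the composition is a genuine induction and every stub is stated over Mathlib + the
route file only. "Lens depth ≤ n" of `(p, k, D)` is written inline as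
`∀ y (s : Finset (Fin k)), (∀ i ∈ s, y ∈ p '' (D i)) → s.card ≤ n` (CLOSED lenses) and its general-position
variant with `interior (p '' (D i))` (OPEN lenses):

* `stub_wrinkled_existence` (E, KNOWN modulo vendoring; = the route's support item `WrinkledExistence`,
  stmt-SmoothPoincare4-10375, BY NAME): every homotopy 4-sphere admits a degree-one wrinkled map to `S⁴` (some `k`).
  Eliashberg–Mishachev 1997, Thm "Wrinkled mappings" (a fibrewise isomorphism `TM → TS⁴` over a degree-one map
  exists by Dold–Whitney since `w₂ = p₁ = 0`, `e = 2` on both sides) + the degree bookkeeping of the route header;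
  grounded "known (EM1997; wanted fact)" on the ledger. Size XL in Lean (needs the vendored fact). Closing that item
  closes this stub by `exact`.
* `stub_lens_shrinking` (S, TRUE and provable, size L–XL): the wrinkles of a degree-one wrinkled map can be SHRUNK
  inside the class: there are `p'`, `D'` (same `k`) with `IsW p' k D'` and every new closed lens inside the INTERIOR
  of the old one, `p' '' (D' i) ⊆ interior (p '' (D i))`. Why true: replace `w = w₁` by the rescaled model
  `w_t(y,z) = (y, z³ + 3(|y|² − t) z) = t^{3/2}·w(y/√t, z/√t)`, `t = 1 − δ`, cut off to `w` on a thin shell around the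
  disc where `w` is an immersion (a `C¹`-small compactly supported perturbation of an immersion on a compact set is an
  immersion); the new lens `lens_t ⊂ int lens₁`; the new charts are the rescaled old ones; the clause "exactly one
  preimage off the lenses" for `p'` is the sheet count `#p'⁻¹(y) = 1 + 2·depth'(y)` at `depth' = 0` (degree one,
  `M ∖ ⋃ D'ᵢ` connected, middle sheets orientation-reversing) — the same degree bookkeeping the support item
  `UnlinkingLemma` needs. It converts OPEN-lens depth bounds into CLOSED-lens depth bounds at every level
  (`depthLE_of_interior_of_shrink`, sorry-free below).
* `stub_depth_descent` (D, THE LOAD-BEARING STUB = the route's DepthReduction in one-step form): if a homotopy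
  4-sphere carries a degree-one wrinkled map of closed lens depth `≤ m + 1` with `m ≥ 2`, it carries one (any number
  of wrinkles) of open lens depth `≤ m` — i.e. the top stratum `{depth = m + 1}` (a compact set covered by
  `(m+1)`-fold lens intersections) can be dissolved without claiming anything at depth `≤ 2` (the guard `2 ≤ m` keeps
  the stub off `DepthTwoRung`'s territory and off the summit: with `m = 1` it would assert depth `≤ 1`, i.e. `M ≅ S⁴`
  by the Unlinking Lemma). Open, crux-hard: no depth-lowering operation is known (wrinkling and chopping RAISE the
  number of lenses; shrinking/parking only separate clean wrinkles); it is implied by the crux (ignore the input), so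
  it adds no falsity risk beyond `DepthTwoCollapse` itself, and together with E and S it is equivalent to it.
* `depthTwoCollapse_of_pieces : E-sig → S-sig → D-sig → (DepthTwoCollapse unfolded)` — THE REAL COMPOSITION,
  sorry-free: from E get `(p₀, k₀, D₀)`, of closed depth `≤ k₀` trivially (`card_finset_fin_le`); by induction on
  `j ≤ k₀ − 2` produce maps of closed depth `≤ k₀ − j` (descend with D at level `m = k₀ − j − 1 ≥ 2`, then shrink with
  S to return from open to closed lenses); at `j = k₀ − 2` (or at once if `k₀ ≤ 2`) the closed depth is `≤ 2`, which is
  the crux's "no three pairwise distinct indices" clause (`Finset.card_eq_three`).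
* `DepthTwoCollapse_of : DepthTwoCollapse` — THE SKELETON THEOREM: the crux BY NAME from the three declared stubs
  through the composition (the file's only theorem whose head symbol is the crux; `ledger skeleton check` shape —
  the skeleton theorem may take no hypotheses other than registered obligations, so the implication content lives in
  `depthTwoCollapse_of_pieces` and `_of` discharges it with the stubs).

`sorry` occurs ONLY in the three `stub_*` theorems.

## Disproof used

None exists: `ledger workitem get stmt-SmoothPoincare4-10373` (2026-08-17) shows no `Disproof.lean`, no `Lines/`, no
landed `Negative/` lemma for this crux, and `ledger negatives --problem SmoothPoincare4` has no statement about wrinkled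
maps / lens depth. The refuter's crux-attack evidence on the item (2026-08-15, sorry-free: `depthTwoCollapse_of_spc4 :
SmoothPoincare4 → DepthTwoCollapse` by the `k = 0` witness; `depthTwoCollapse_iff_spc4_of_rung : DepthTwoRung →
(DepthTwoCollapse ↔ SmoothPoincare4)`; the `k = 0` slice of `IsW` is literally a diffeomorphism) is honoured: no stub
has a `k = 0` / depth-`≤ 1` instance (descent is guarded by `2 ≤ m`; shrinking keeps `k`), so no stub is the summit in
costume, and the line uses existence (E) exactly where the refuter shows the crux cannot be reached from below.

## BC3 probes

For each stub `X`: `X → DepthTwoCollapse` and `X → SmoothPoincare4` by `first | exact? | simpa | aesop` (and the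
`intro h; … simpa using h …` variant, plus each alternative alone), files `bc/probe_*.lean`, `bc/probe2_*.lean` in the
registrar's folder — all FAIL: `exact?` cannot close the goal, `simpa`/`aesop` fail or exhaust 400000 heartbeats
(recorded in the registrar's NOTES.md and in `Lines/birth.md`).

## References

* Y. Eliashberg, N. Mishachev, *Wrinkling of smooth mappings and its applications I*, Invent. Math. 130 (1997)
  345–369, doi:10.1007/s002220050188 — Thm "Wrinkled mappings", §2 (standard wrinkle, fibred character, chopping).
  [EliashbergMishachev1997]
* Y. Eliashberg, N. Mishachev, *Wrinkled embeddings*, Contemp. Math. 498 (2009), arXiv:1108.1265 — defs 4.1–4.6,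
  Thms 4.4–4.5. [EliashbergMishachev2009]
* O. Saeki, K. Sakuma, *Stable maps between 4-manifolds and elimination of their singularities*, J. London Math.
  Soc. 59 (1999), doi:10.1112/s0024610799007401 — Thm 2.1 / Rem 2.2 (fold and fold–cusp maps Σ⁴ → S⁴ in every
  degree). [SaekiSakuma1999]
* J. Milnor, *Topology from the differentiable viewpoint* (1965), §5 (Brouwer degree, sheet counting).
  [MilnorTFDV1965]
-/

-- `Summit.<Summit>.<Problem>`: single-conjunct summit, the duplicate component is mandated (CONVENTIONS §2).
set_option linter.dupNamespace false
set_option linter.unusedVariables false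

noncomputable section

namespace Summit.SmoothPoincare4.SmoothPoincare4.Cruxes.DepthTwoCollapse.Birth

open scoped Manifold ContDiff Topology ContinuousMap
open Set Function
open Summit.SmoothPoincare4.SmoothPoincare4.Theses.WrinkleUnlinking

/-! ## The three registered stubs

Vocabulary (all inline, Mathlib + the route file only): `S⁴ := Metric.sphere (0 : EuclideanSpace ℝ (Fin 5)) 1`
(model `𝓡 4`); `M` ranges over the binders of `SmoothPoincare4`; "`(p, k, D)` is a degree-one wrinkled map" is the
route's inlined predicate (smooth; `D i` pairwise disjoint; local diffeomorphism off `⋃ D i`; exactly one preimage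
over every point off the lens images `p '' (D i)` and such a point exists; Eliashberg–Mishachev normal form on each
`D i` through injective local-diffeomorphism charts `φ`, `ψ` with `φ '' (D i)` the closed unit ball); "closed lens
depth `≤ n`" is `∀ y (s : Finset (Fin k)), (∀ i ∈ s, y ∈ p '' (D i)) → s.card ≤ n`, "open lens depth `≤ n`" the same
with `interior (p '' (D i))`. -/

/-- **Stub E `stub_wrinkled_existence` — degree-one wrinkled maps exist (Eliashberg–Mishachev).** Every homotopy
4-sphere admits a degree-one wrinkled map to `S⁴` with some number `k` of wrinkles: literally the route's support
item `WrinkledExistence` (stmt-SmoothPoincare4-10375), taken BY NAME so that closing that item closes this stub by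
`exact`. Why true: a degree-one map `M → S⁴` is covered by a fibrewise isomorphism `TM → TS⁴` (Dold–Whitney:
`w₂ = p₁ = 0`, `e = 2` on both sides), so Eliashberg–Mishachev's theorem "Wrinkled mappings" C⁰-approximates it by a
wrinkled map; `M ∖ ⋃ Dᵢ` is connected, so all sheets over a depth-0 point carry one sign and there is exactly one.
Known modulo vendoring the E–M theorem as a named fact (grounded so on the ledger); size XL.
[EliashbergMishachev1997, Thm "Wrinkled mappings"] [SaekiSakuma1999, Rem 2.2] -/
theorem stub_wrinkled_existence : WrinkledExistence := by
  sorry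

/-- **Stub S `stub_lens_shrinking` — wrinkles can be shrunk inside the class (TRUE; general position for lenses).**
For every degree-one wrinkled map `(p, k, D)` on a homotopy 4-sphere there is a degree-one wrinkled map `(p', k, D')`
(same number of wrinkles) each of whose closed lens images lies in the INTERIOR of the corresponding old one:
`p' '' (D' i) ⊆ interior (p '' (D i))`. Why true: on the chart of wrinkle `i` replace the model `w = w₁` by
`w_t(y,z) = (y, z³ + 3(|y|² − t)z) = t^{3/2} w(y/√t, z/√t)` with `t = 1 − δ`, cut off to `w` on a thin shell around
the disc where `w` is an immersion (`C¹`-small perturbation, `δ` small against the shell width); `lens_t ⊂ int lens₁`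
strictly; new charts = rescaled old charts; the "exactly one preimage off the new lenses" clause is the degree-one
sheet count `1 + 2·depth` at depth `0` (middle sheets reverse orientation, `M ∖ ⋃ D'ᵢ` is connected). Consequence
used by the composition: an OPEN-lens depth bound for `p` becomes a CLOSED-lens depth bound for `p'`. Size L–XL
(cut-off estimates near the fold sphere + smooth degree theory, as for the support item `UnlinkingLemma`).
[EliashbergMishachev1997, §2] [MilnorTFDV1965, §5] -/
theorem stub_lens_shrinking :
    ∀ (M : Type) [TopologicalSpace M] [T2Space M] [SecondCountableTopology M] [ChartedSpace (EuclideanSpace ℝ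
    (Fin 4)) M] [IsManifold (𝓡 4) ∞ M], (M ≃ₕ Metric.sphere (0 : EuclideanSpace ℝ (Fin 5)) 1) → ∀ (p : M →
    Metric.sphere (0 : EuclideanSpace ℝ (Fin 5)) 1) (k : ℕ) (D : Fin k → Set M), (ContMDiff (𝓡 4) (𝓡 4) ∞ p ∧
    Pairwise (Function.onFun Disjoint D) ∧ (∀ x, x ∉ (⋃ i, D i) → IsLocalDiffeomorphAt (𝓡 4) (𝓡 4) ∞ p x) ∧ (∀
    y, y ∉ (⋃ i, p '' (D i)) → ∃! x, p x = y) ∧ (∃ y, y ∉ ⋃ i, p '' (D i)) ∧ ∀ i, ∃ (U : Set M) (φ : M →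
    EuclideanSpace ℝ (Fin 4)) (V : Set (Metric.sphere (0 : EuclideanSpace ℝ (Fin 5)) 1)) (ψ : (Metric.sphere (0
    : EuclideanSpace ℝ (Fin 5)) 1) → EuclideanSpace ℝ (Fin 4)), IsOpen U ∧ D i ⊆ U ∧ Set.InjOn φ U ∧ (∀ x ∈ U,
    IsLocalDiffeomorphAt (𝓡 4) (𝓡 4) ∞ φ x) ∧ φ '' (D i) = Metric.closedBall (0 : EuclideanSpace ℝ (Fin 4)) 1 ∧
    IsOpen V ∧ p '' U ⊆ V ∧ Set.InjOn ψ V ∧ (∀ y ∈ V, IsLocalDiffeomorphAt (𝓡 4) (𝓡 4) ∞ ψ y) ∧ ∀ x ∈ U, ψ (p x)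
    = WithLp.toLp 2 (fun j : Fin 4 => if j = 3 then (φ x 3) ^ 3 + 3 * ((φ x 0) ^ 2 + (φ x 1) ^ 2 + (φ x 2) ^ 2 -
    1) * φ x 3 else φ x j)) → ∃ (p' : M → Metric.sphere (0 : EuclideanSpace ℝ (Fin 5)) 1) (D' : Fin k → Set M),
    (ContMDiff (𝓡 4) (𝓡 4) ∞ p' ∧ Pairwise (Function.onFun Disjoint D') ∧ (∀ x, x ∉ (⋃ i, D' i) →
    IsLocalDiffeomorphAt (𝓡 4) (𝓡 4) ∞ p' x) ∧ (∀ y, y ∉ (⋃ i, p' '' (D' i)) → ∃! x, p' x = y) ∧ (∃ y, y ∉ ⋃ i,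
    p' '' (D' i)) ∧ ∀ i, ∃ (U : Set M) (φ : M → EuclideanSpace ℝ (Fin 4)) (V : Set (Metric.sphere (0 :
    EuclideanSpace ℝ (Fin 5)) 1)) (ψ : (Metric.sphere (0 : EuclideanSpace ℝ (Fin 5)) 1) → EuclideanSpace ℝ (Fin
    4)), IsOpen U ∧ D' i ⊆ U ∧ Set.InjOn φ U ∧ (∀ x ∈ U, IsLocalDiffeomorphAt (𝓡 4) (𝓡 4) ∞ φ x) ∧ φ '' (D' i) =
    Metric.closedBall (0 : EuclideanSpace ℝ (Fin 4)) 1 ∧ IsOpen V ∧ p' '' U ⊆ V ∧ Set.InjOn ψ V ∧ (∀ y ∈ V,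
    IsLocalDiffeomorphAt (𝓡 4) (𝓡 4) ∞ ψ y) ∧ ∀ x ∈ U, ψ (p' x) = WithLp.toLp 2 (fun j : Fin 4 => if j = 3 then
    (φ x 3) ^ 3 + 3 * ((φ x 0) ^ 2 + (φ x 1) ^ 2 + (φ x 2) ^ 2 - 1) * φ x 3 else φ x j)) ∧ ∀ i, p' '' (D' i) ⊆
    interior (p '' (D i)) := by
  sorry

/-- **Stub D `stub_depth_descent` — ONE-STEP DEPTH DESCENT above depth two (the load-bearing stub).** If a homotopy
4-sphere `M` carries a degree-one wrinkled map `(p, k, D)` of closed lens depth `≤ m + 1` with `2 ≤ m`, then it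
carries a degree-one wrinkled map `(p', k', D')` (any `k'`) of OPEN lens depth `≤ m`: the top stratum
`{y : depth y = m + 1}` can be dissolved. This is the route's foreseen `DepthReduction` in inductive form; the guard
`2 ≤ m` keeps it strictly above the recognition rungs (`m = 1` would give depth `≤ 1`, i.e. `M ≅ S⁴` by the Unlinking
Lemma — summit territory). Why it might fail: no operation lowering lens depth is known — wrinkling/chopping raise
the number of lenses, shrinking and parking only separate CLEAN wrinkles, and a minimal-depth presentation of an
exotic `Σ` (if any) has every top-stratum lens clasped; it is implied by the crux (ignore the input) and, with E and
S, equivalent to it. Open; crux-hard. [EliashbergMishachev1997, §2 (surgery of wrinkles)] [EliashbergMishachev2009,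
Thm 4.5] [SaekiSakuma1999] -/
theorem stub_depth_descent :
    ∀ (M : Type) [TopologicalSpace M] [T2Space M] [SecondCountableTopology M] [ChartedSpace (EuclideanSpace ℝ
    (Fin 4)) M] [IsManifold (𝓡 4) ∞ M], (M ≃ₕ Metric.sphere (0 : EuclideanSpace ℝ (Fin 5)) 1) → ∀ (p : M →
    Metric.sphere (0 : EuclideanSpace ℝ (Fin 5)) 1) (k : ℕ) (D : Fin k → Set M), (ContMDiff (𝓡 4) (𝓡 4) ∞ p ∧
    Pairwise (Function.onFun Disjoint D) ∧ (∀ x, x ∉ (⋃ i, D i) → IsLocalDiffeomorphAt (𝓡 4) (𝓡 4) ∞ p x) ∧ (∀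
    y, y ∉ (⋃ i, p '' (D i)) → ∃! x, p x = y) ∧ (∃ y, y ∉ ⋃ i, p '' (D i)) ∧ ∀ i, ∃ (U : Set M) (φ : M →
    EuclideanSpace ℝ (Fin 4)) (V : Set (Metric.sphere (0 : EuclideanSpace ℝ (Fin 5)) 1)) (ψ : (Metric.sphere (0
    : EuclideanSpace ℝ (Fin 5)) 1) → EuclideanSpace ℝ (Fin 4)), IsOpen U ∧ D i ⊆ U ∧ Set.InjOn φ U ∧ (∀ x ∈ U,
    IsLocalDiffeomorphAt (𝓡 4) (𝓡 4) ∞ φ x) ∧ φ '' (D i) = Metric.closedBall (0 : EuclideanSpace ℝ (Fin 4)) 1 ∧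
    IsOpen V ∧ p '' U ⊆ V ∧ Set.InjOn ψ V ∧ (∀ y ∈ V, IsLocalDiffeomorphAt (𝓡 4) (𝓡 4) ∞ ψ y) ∧ ∀ x ∈ U, ψ (p x)
    = WithLp.toLp 2 (fun j : Fin 4 => if j = 3 then (φ x 3) ^ 3 + 3 * ((φ x 0) ^ 2 + (φ x 1) ^ 2 + (φ x 2) ^ 2 -
    1) * φ x 3 else φ x j)) → ∀ m : ℕ, 2 ≤ m → (∀ (y : Metric.sphere (0 : EuclideanSpace ℝ (Fin 5)) 1) (s :
    Finset (Fin k)), (∀ i ∈ s, y ∈ p '' (D i)) → s.card ≤ m + 1) → ∃ (p' : M → Metric.sphere (0 : EuclideanSpace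
    ℝ (Fin 5)) 1) (k' : ℕ) (D' : Fin k' → Set M), (ContMDiff (𝓡 4) (𝓡 4) ∞ p' ∧ Pairwise (Function.onFun
    Disjoint D') ∧ (∀ x, x ∉ (⋃ i, D' i) → IsLocalDiffeomorphAt (𝓡 4) (𝓡 4) ∞ p' x) ∧ (∀ y, y ∉ (⋃ i, p' '' (D'
    i)) → ∃! x, p' x = y) ∧ (∃ y, y ∉ ⋃ i, p' '' (D' i)) ∧ ∀ i, ∃ (U : Set M) (φ : M → EuclideanSpace ℝ (Fin 4))
    (V : Set (Metric.sphere (0 : EuclideanSpace ℝ (Fin 5)) 1)) (ψ : (Metric.sphere (0 : EuclideanSpace ℝ (Fin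
    5)) 1) → EuclideanSpace ℝ (Fin 4)), IsOpen U ∧ D' i ⊆ U ∧ Set.InjOn φ U ∧ (∀ x ∈ U, IsLocalDiffeomorphAt (𝓡
    4) (𝓡 4) ∞ φ x) ∧ φ '' (D' i) = Metric.closedBall (0 : EuclideanSpace ℝ (Fin 4)) 1 ∧ IsOpen V ∧ p' '' U ⊆ V
    ∧ Set.InjOn ψ V ∧ (∀ y ∈ V, IsLocalDiffeomorphAt (𝓡 4) (𝓡 4) ∞ ψ y) ∧ ∀ x ∈ U, ψ (p' x) = WithLp.toLp 2 (fun
    j : Fin 4 => if j = 3 then (φ x 3) ^ 3 + 3 * ((φ x 0) ^ 2 + (φ x 1) ^ 2 + (φ x 2) ^ 2 - 1) * φ x 3 else φ x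
    j)) ∧ (∀ (y : Metric.sphere (0 : EuclideanSpace ℝ (Fin 5)) 1) (s : Finset (Fin k')), (∀ i ∈ s, y ∈ interior
    (p' '' (D' i))) → s.card ≤ m) := by
  sorry

/-! ## Sorry-free infrastructure: the inlined predicates as local notations (composition only)

The stubs above are spelled out; the notations below are parametric `local notation`s (pure macros, no declarations —
in particular no untagged `Prop`-valued definitions under `Summit.*`) expanding VERBATIM to the inlined texts, so the
stubs are accepted where the notations are written (syntactic identity up to bound-variable names). -/

/-- Local notation (infrastructure and composition only): the round 4-sphere. -/
local notation "𝕊⁴" => (Metric.sphere (0 : EuclideanSpace ℝ (Fin 5)) 1)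

/- `IsW⟪M, p, D⟫` — the route's inlined predicate "`(p, k, D)` is a degree-one wrinkled map on `M`", verbatim
(composition-side macro; expands to the text inside every item of the route and every stub above; `k` is read off the
type of `D : Fin k → Set M`). [EliashbergMishachev1997, §1] -/
set_option quotPrecheck false in
local notation "IsW⟪" M ", " p ", " D "⟫" =>
  (ContMDiff (𝓡 4) (𝓡 4) ∞ p ∧ Pairwise (Function.onFun Disjoint D) ∧ (∀ x, x ∉ (⋃ i, D i) → IsLocalDiffeomorphAt
  (𝓡 4) (𝓡 4) ∞ p x) ∧ (∀ y, y ∉ (⋃ i, p '' (D i)) → ∃! x, p x = y) ∧ (∃ y, y ∉ ⋃ i, p '' (D i)) ∧ ∀ i, ∃ (U :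
  Set M) (φ : M → EuclideanSpace ℝ (Fin 4)) (V : Set (Metric.sphere (0 : EuclideanSpace ℝ (Fin 5)) 1)) (ψ :
  (Metric.sphere (0 : EuclideanSpace ℝ (Fin 5)) 1) → EuclideanSpace ℝ (Fin 4)), IsOpen U ∧ D i ⊆ U ∧ Set.InjOn φ
  U ∧ (∀ x ∈ U, IsLocalDiffeomorphAt (𝓡 4) (𝓡 4) ∞ φ x) ∧ φ '' (D i) = Metric.closedBall (0 : EuclideanSpace ℝ
  (Fin 4)) 1 ∧ IsOpen V ∧ p '' U ⊆ V ∧ Set.InjOn ψ V ∧ (∀ y ∈ V, IsLocalDiffeomorphAt (𝓡 4) (𝓡 4) ∞ ψ y) ∧ ∀ x ∈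
  U, ψ (p x) = WithLp.toLp 2 (fun j : Fin 4 => if j = 3 then (φ x 3) ^ 3 + 3 * ((φ x 0) ^ 2 + (φ x 1) ^ 2 + (φ x
  2) ^ 2 - 1) * φ x 3 else φ x j))

/- `DepthLE⟪p, k, D, n⟫` — closed lens depth `≤ n`: no point of `S⁴` lies in more than `n` of the closed lens images
`p '' (D i)` (finite-set form). [folklore] -/
set_option quotPrecheck false in
local notation "DepthLE⟪" p ", " k ", " D ", " n "⟫" =>
  (∀ (y : 𝕊⁴) (s : Finset (Fin k)), (∀ i ∈ s, y ∈ p '' (D i)) → s.card ≤ n)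

/- `IntDepthLE⟪p, k, D, n⟫` — open lens depth `≤ n`: the same with the interiors `interior (p '' (D i))` (the
general-position form a geometric construction delivers; closed and open depth differ only by lenses touching along
their boundary fold/cusp images). [folklore] -/
set_option quotPrecheck false in
local notation "IntDepthLE⟪" p ", " k ", " D ", " n "⟫" =>
  (∀ (y : 𝕊⁴) (s : Finset (Fin k)), (∀ i ∈ s, y ∈ interior (p '' (D i))) → s.card ≤ n)

/-- A map with `k` wrinkles has closed lens depth `≤ k` (there are only `k` lenses). [folklore] -/
theorem depthLE_self (M : Type) (p : M → 𝕊⁴) (k : ℕ) (D : Fin k → Set M) : DepthLE⟪p, k, D, k⟫ :=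
  fun _ s _ => card_finset_fin_le s

/-- Monotonicity of the depth bound. [folklore] -/
theorem depthLE_mono (M : Type) (p : M → 𝕊⁴) (k : ℕ) (D : Fin k → Set M) {n n' : ℕ} (h : n ≤ n')
    (hd : DepthLE⟪p, k, D, n⟫) : DepthLE⟪p, k, D, n'⟫ :=
  fun y s hs => (hd y s hs).trans h

/-- **Open-to-closed transfer along a shrinking** (the use of stub S): if the new closed lenses lie inside the old
open lenses, an open-lens depth bound for the old map is a closed-lens depth bound for the new one. [folklore] -/
theorem depthLE_of_interior_of_shrink (M : Type) (p p' : M → 𝕊⁴) (k : ℕ) (D D' : Fin k → Set M) (n : ℕ)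
    (hint : IntDepthLE⟪p, k, D, n⟫) (hsub : ∀ i, p' '' (D' i) ⊆ interior (p '' (D i))) :
    DepthLE⟪p', k, D', n⟫ :=
  fun y s hs => hint y s fun i hi => hsub i (hs i hi)

/-- **Closed depth `≤ 2` is the crux's clause** "no point lies in the lens images of three pairwise distinct
wrinkles" (`{i, j, l}` has three elements, `Finset.card_eq_three`). [folklore] -/
theorem no_triple_of_depthLE_two (M : Type) (p : M → 𝕊⁴) (k : ℕ) (D : Fin k → Set M)
    (hd : DepthLE⟪p, k, D, 2⟫) :
    ∀ (y : 𝕊⁴) (i j l : Fin k), i ≠ j → j ≠ l → i ≠ l →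
      ¬ (y ∈ p '' (D i) ∧ y ∈ p '' (D j) ∧ y ∈ p '' (D l)) := by
  intro y i j l hij hjl hil hmem
  obtain ⟨hi, hj, hl⟩ := hmem
  have hcard : ({i, j, l} : Finset (Fin k)).card = 3 :=
    Finset.card_eq_three.mpr ⟨i, j, l, hij, hil, hjl, rfl⟩
  have hle : ({i, j, l} : Finset (Fin k)).card ≤ 2 := by
    refine hd y {i, j, l} ?_
    intro x hx
    simp only [Finset.mem_insert, Finset.mem_singleton] at hx
    rcases hx with rfl | rfl | rfl
    · exact hi
    · exact hj
    · exact hl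
  omega

/-! ## The composition: the three stubs prove the crux (induction on the depth level) -/

/-- **Composition with explicit hypotheses** (`E-sig → S-sig → D-sig → DepthTwoCollapse unfolded one step`, so that
`DepthTwoCollapse_of` below is the file's only theorem whose head symbol is the crux name). Proof: E gives
`(p₀, k₀, D₀)`, of closed depth `≤ k₀` (`depthLE_self`); CLAIM by induction on `j`: for `j + 2 ≤ k₀` there is a
degree-one wrinkled map of closed depth `≤ k₀ − j` — step: descend with D at level `m := k₀ − (j+1) ≥ 2` (closed
`≤ m + 1` in, open `≤ m` out), then shrink with S (`depthLE_of_interior_of_shrink`: open `≤ m` for the descended map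
is closed `≤ m` for the shrunk one); at `j := k₀ − 2` (or directly from `(p₀, k₀, D₀)` when `k₀ ≤ 2`, by
monotonicity) the closed depth is `≤ 2`, which `no_triple_of_depthLE_two` turns into the crux's clause. Sorry-free,
standard axioms. [folklore] -/
theorem depthTwoCollapse_of_pieces
    (hE : WrinkledExistence)
    (hS : ∀ (M : Type) [TopologicalSpace M] [T2Space M] [SecondCountableTopology M]
      [ChartedSpace (EuclideanSpace ℝ (Fin 4)) M] [IsManifold (𝓡 4) ∞ M], (M ≃ₕ 𝕊⁴) →
      ∀ (p : M → 𝕊⁴) (k : ℕ) (D : Fin k → Set M), IsW⟪M, p, D⟫ →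
        ∃ (p' : M → 𝕊⁴) (D' : Fin k → Set M), IsW⟪M, p', D'⟫ ∧ ∀ i, p' '' (D' i) ⊆ interior (p '' (D i)))
    (hD : ∀ (M : Type) [TopologicalSpace M] [T2Space M] [SecondCountableTopology M]
      [ChartedSpace (EuclideanSpace ℝ (Fin 4)) M] [IsManifold (𝓡 4) ∞ M], (M ≃ₕ 𝕊⁴) →
      ∀ (p : M → 𝕊⁴) (k : ℕ) (D : Fin k → Set M), IsW⟪M, p, D⟫ → ∀ m : ℕ, 2 ≤ m →
        DepthLE⟪p, k, D, m + 1⟫ →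
        ∃ (p' : M → 𝕊⁴) (k' : ℕ) (D' : Fin k' → Set M), IsW⟪M, p', D'⟫ ∧ IntDepthLE⟪p', k', D', m⟫) :
    ∀ (M : Type) [TopologicalSpace M] [T2Space M] [SecondCountableTopology M]
      [ChartedSpace (EuclideanSpace ℝ (Fin 4)) M] [IsManifold (𝓡 4) ∞ M], (M ≃ₕ 𝕊⁴) →
      ∃ (p : M → 𝕊⁴) (k : ℕ) (D : Fin k → Set M), IsW⟪M, p, D⟫ ∧
        ∀ (y : 𝕊⁴) (i j l : Fin k), i ≠ j → j ≠ l → i ≠ l →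
          ¬ (y ∈ p '' (D i) ∧ y ∈ p '' (D j) ∧ y ∈ p '' (D l)) := by
  intro M _ _ _ _ _ e
  -- E: a degree-one wrinkled map with some number k₀ of wrinkles (closed depth ≤ k₀ for free)
  obtain ⟨p₀, k₀, D₀, hW₀⟩ := hE M e
  have hW₀' : IsW⟪M, p₀, D₀⟫ := hW₀
  -- CLAIM: for every `j` with `j + 2 ≤ k₀`, a degree-one wrinkled map of closed depth `≤ k₀ - j`
  have key : ∀ j : ℕ, j + 2 ≤ k₀ →
      ∃ (p : M → 𝕊⁴) (k : ℕ) (D : Fin k → Set M), IsW⟪M, p, D⟫ ∧ DepthLE⟪p, k, D, k₀ - j⟫ := by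
    intro j
    induction j with
    | zero =>
      intro _
      exact ⟨p₀, k₀, D₀, hW₀', depthLE_self M p₀ k₀ D₀⟩
    | succ j ih =>
      intro hj
      obtain ⟨p, k, D, hW, hdep⟩ := ih (by omega)
      -- descend at level m := k₀ - (j + 1) ≥ 2 : closed depth ≤ m + 1 in, open depth ≤ m out
      have hm : 2 ≤ k₀ - (j + 1) := by omega
      have hdep' : DepthLE⟪p, k, D, k₀ - (j + 1) + 1⟫ :=
        depthLE_mono M p k D (by omega) hdep
      obtain ⟨p₁, k₁, D₁, hW₁, hint₁⟩ := hD M e p k D hW (k₀ - (j + 1)) hm hdep'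
      -- shrink: open depth ≤ m for (p₁, D₁) is closed depth ≤ m for the shrunk map (p₂, D₂)
      obtain ⟨p₂, D₂, hW₂, hsub₂⟩ := hS M e p₁ k₁ D₁ hW₁
      exact ⟨p₂, k₁, D₂, hW₂, depthLE_of_interior_of_shrink M p₁ p₂ k₁ D₁ D₂ _ hint₁ hsub₂⟩
  -- conclude at level 2
  by_cases hk : 2 ≤ k₀
  · obtain ⟨p, k, D, hW, hdep⟩ := key (k₀ - 2) (by omega)
    exact ⟨p, k, D, hW, no_triple_of_depthLE_two M p k D (depthLE_mono M p k D (by omega) hdep)⟩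
  · exact ⟨p₀, k₀, D₀, hW₀',
      no_triple_of_depthLE_two M p₀ k₀ D₀ (depthLE_mono M p₀ k₀ D₀ (by omega) (depthLE_self M p₀ k₀ D₀))⟩

/-- **THE SKELETON THEOREM.** The crux
`Summit.SmoothPoincare4.SmoothPoincare4.Theses.WrinkleUnlinking.DepthTwoCollapse`, concluded BY NAME from the three
DECLARED stubs `stub_wrinkled_existence`, `stub_lens_shrinking`, `stub_depth_descent` (the only `sorry`s of the file)
through the sorry-free composition `depthTwoCollapse_of_pieces` (the stubs' spelled-out statements are syntactically the
composition's hypotheses, written there through local notations). [folklore] -/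
theorem DepthTwoCollapse_of :
    Summit.SmoothPoincare4.SmoothPoincare4.Theses.WrinkleUnlinking.DepthTwoCollapse :=
  depthTwoCollapse_of_pieces stub_wrinkled_existence stub_lens_shrinking stub_depth_descent

end Summit.SmoothPoincare4.SmoothPoincare4.Cruxes.DepthTwoCollapse.Birth
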